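import Literature.MathematicalPhysics.QuantumLattice.TwoClusterFock
import Literature.MathematicalPhysics.QuantumLattice.ClusterPairBosonCouplings
import Literature.MathematicalPhysics.QuantumLattice.TorusPairSusceptibility
import Literature.MathematicalPhysics.QuantumLattice.SpectralProjectionDerivProofs
import Literature.MathematicalPhysics.QuantumLattice.PlaquettePairCouplings
import Literature.MathematicalPhysics.QuantumLattice.HubbardModel
import HarnessLib

/-!
# `interClusterKernel` IS Kato's second-order kernel of two coupled fermionic clusters

`ClusterPairBosonCouplings` defines (1) the pair resolvent kernel
`pairResolvent hA E a b c d = Σ_{μ,ν} ⟨a,u_μ⟩⟨u_μ,b⟩⟨c,u_ν⟩⟨u_ν,d⟩ / (λ_μ + λ_ν − E)` over Mathlib's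
orthonormal eigenbasis of a Hermitian `A`, announcing that it is the matrix element
`⟨a ⊗ c| (A ⊗ 1 + 1 ⊗ A − E)⁻¹_red |b ⊗ d⟩` of Kato's reduced resolvent of the Kronecker sum, and
(2) the one-cluster formula `interClusterKernel hH φ W κ' κ` (four pair resolvents with the signs
`+, +, −, −`), announcing that it is `⟨φ_{κ'.1} ⊗ φ_{κ'.2}| V (E − H₀)⁻¹_red V |φ_{κ.1} ⊗ φ_{κ.2}⟩`
for the two-cluster system on `Fock (ι ⊕ₗ ι)` with the inter-cluster Jordan–Wigner sign built in —
BOTH identifications being deferred there ("NOT here"). THIS FILE PROVES BOTH, and specialises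
them to the plaquette of `PlaquettePairCouplings`:

**A. Linear algebra.** `tensorVec a c (i,j) = a i · c j`, `kroneckerSum A B = A ⊗ₖ 1 + 1 ⊗ₖ B`
(Mathlib's Kronecker product); `(A ⊗ 1 + 1 ⊗ B)(x ⊗ y) = Ax ⊗ y + x ⊗ By`, product eigenvectors,
`⟨a ⊗ c, b ⊗ d⟩ = ⟨a,b⟩⟨c,d⟩`, completeness `v = Σ_μ ⟨u_μ, v⟩ u_μ`, and
`pairResolvent_eq_dotProduct_reducedResolvent_kroneckerSum :
 pairResolvent hA E a b c d = ⟨a ⊗ c, reducedResolvent (kroneckerSum A A) E (b ⊗ d)⟩`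
(`reducedResolvent H₀ E = cfc (x ↦ (x − E)⁻¹) H₀`; Lean's `0⁻¹ = 0` drops the `E`-eigenspace on both
sides).

**B. Fermions.** With `twoClusterHamiltonian H = jwEmbed inlO H + jwEmbed inrO H`,
`interClusterHopping W = −Σ_{i,j} W i j (c†_{inl i} c_{inr j} + c†_{inr j} c_{inl i})` and the product
states of `TwoClusterFock`: resolvent matrix elements between product states are pair resolvents
(`star_prodState_dotProduct_reducedResolvent_prodState`); the hopping maps a product state with
cluster-1 parity `p` to `(-1)^p Σ W i j [(c_i x) ⊗ (c†_j y) − (c†_i x) ⊗ (c_j y)]`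
(`interClusterHopping_mulVec_prodState` — the string `(-1)^{N₁}` read before / after the cluster-1
operator: the relative sign between pair-transfer and out-and-back processes); and THE IDENTIFICATION
`interClusterKernel_eq : ⟨φ_{κ'.1} ⊗ φ_{κ'.2}, (V · S(E) · V)(φ_{κ.1} ⊗ φ_{κ.2})⟩ = − interClusterKernel hH φ W κ' κ`
for Hermitian parity-preserving `H`, real `W`, cluster-1 states of a common parity, at
`E = (pairEnergy κ + pairEnergy κ')/2` (the physicists' `(E − H₀)⁻¹(1 − P)` is `−S(E)`). No
eigenvector or gap hypothesis: an identity of finite matrices.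

**C. The plaquette.** Hubbard Hamiltonians are even (`isParityPreserving_hamiltonian`), the plaquette
states are even, hence `plaquetteKernel_eq : plaquetteKernel U κ' κ = −⟨Ψ_κ', V S(E) V Ψ_κ⟩` on the
16-orbital two-plaquette Fock space (`V` = unit hopping on the two boundary bonds `plaquetteBonds`),
and `plaquettePairCouplings_J_eq`: the pair-hopping coupling `J(U)` IS the real part of the
second-order pair-transfer amplitude `⟨|2h⟩ ⊗ |0h⟩, V S(E(0h)+E(2h)) V (|0h⟩ ⊗ |2h⟩)⟩`, i.e. the sign
convention `H_eff ∋ −J (b†_R b_{R'} + h.c.)` of Yao–Tsai–Kivelson 2007, eq. (2) is now a theorem about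
the tree's definition (numerically, in these conventions, `J(2) = 12.56`, `V/2J = 0.9859, 0.9928,
0.9986, 1.0033` at `U = 1, 2, 2.5, 3`; prover evidence on stmt-HubbardSuperconductivity-8148).

References: T. Kato, *Perturbation theory for linear operators* (1966), I-§5.3 (5.32), II-§2.2 (2.20)
[Kato1966]; W.-F. Tsai, S. A. Kivelson, PRB 73 (2006) 214510, App. A (A1)–(A3) [TsaiKivelson2006];
H. Yao, W.-F. Tsai, S. A. Kivelson, PRB 76 (2007) 161104(R), eq. (2) [YaoTsaiKivelson2007].
Tree: `Matrix.IsHermitian.cfc_mulVec_of_eigenvector`, `star_eigenvectorUnitary_mulVec_apply`,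
`star_dotProduct_mulVec` (`TorusPairSusceptibility`); `mulVec_eigenvectorBasis_coe`
(`SpectralProjectionDerivProofs`); `reducedResolvent`, `pairResolvent`, `interClusterKernel`,
`bondHopping` (`ClusterPairBosonCouplings`); `plaquetteKernel`, `plaquetteStates`,
`plaquetteKernel_hop_re` (`PlaquettePairCouplings`). Mathlib: `Matrix.kroneckerMap` (`⊗ₖ`),
`conjTranspose_kronecker`, `Matrix.IsHermitian.eigenvectorUnitary`.
-/

noncomputable section

namespace Literature.MathematicalPhysics.QuantumLattice

open Matrix
open scoped Kronecker

section TensorVec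

variable {n m : Type*}

/-- The **product (tensor) vector** `a ⊗ c` on the product index type: `(a ⊗ c)(i, j) = a i · c j`
(the coordinates of a simple tensor in the product basis). [folklore] -/
def tensorVec (a : n → ℂ) (c : m → ℂ) : n × m → ℂ := fun p => a p.1 * c p.2

/-- Entries of a product vector. [folklore] -/
@[simp] theorem tensorVec_apply (a : n → ℂ) (c : m → ℂ) (p : n × m) :
    tensorVec a c p = a p.1 * c p.2 := rfl

/-- `(s • a) ⊗ c = s • (a ⊗ c)`. [folklore] -/
theorem tensorVec_smul_left (s : ℂ) (a : n → ℂ) (c : m → ℂ) :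
    tensorVec (s • a) c = s • tensorVec a c := by
  funext p; simp [tensorVec, mul_assoc]

/-- `a ⊗ (s • c) = s • (a ⊗ c)`. [folklore] -/
theorem tensorVec_smul_right (s : ℂ) (a : n → ℂ) (c : m → ℂ) :
    tensorVec a (s • c) = s • tensorVec a c := by
  funext p; simp [tensorVec]; ring

/-- `(a + a') ⊗ c = a ⊗ c + a' ⊗ c`. [folklore] -/
theorem tensorVec_add_left (a a' : n → ℂ) (c : m → ℂ) :
    tensorVec (a + a') c = tensorVec a c + tensorVec a' c := by
  funext p; simp [tensorVec, add_mul]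

/-- `a ⊗ (c + c') = a ⊗ c + a ⊗ c'`. [folklore] -/
theorem tensorVec_add_right (a : n → ℂ) (c c' : m → ℂ) :
    tensorVec a (c + c') = tensorVec a c + tensorVec a c' := by
  funext p; simp [tensorVec, mul_add]

/-- **Bilinearity**: the product of two finite linear combinations is the double linear
combination of the products. [folklore] -/
theorem tensorVec_sum_smul_sum_smul {ι κ : Type*} (s : Finset ι) (t : Finset κ)
    (α : ι → ℂ) (u : ι → n → ℂ) (β : κ → ℂ) (w : κ → m → ℂ) :
    tensorVec (∑ μ ∈ s, α μ • u μ) (∑ ν ∈ t, β ν • w ν) =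
      ∑ μ ∈ s, ∑ ν ∈ t, (α μ * β ν) • tensorVec (u μ) (w ν) := by
  funext p
  simp only [tensorVec, Finset.sum_apply, Pi.smul_apply, smul_eq_mul]
  rw [Finset.sum_mul_sum]
  exact Finset.sum_congr rfl fun μ _ => Finset.sum_congr rfl fun ν _ => by ring

variable [Fintype n] [Fintype m]

/-- **Inner products factor**: `⟨a ⊗ c, b ⊗ d⟩ = ⟨a, b⟩ · ⟨c, d⟩` (`⟨x, y⟩ = star x ⬝ᵥ y`).
[folklore] -/
theorem star_tensorVec_dotProduct_tensorVec (a b : n → ℂ) (c d : m → ℂ) :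
    star (tensorVec a c) ⬝ᵥ tensorVec b d = (star a ⬝ᵥ b) * (star c ⬝ᵥ d) := by
  simp only [dotProduct, Pi.star_apply, tensorVec_apply, star_mul', Fintype.sum_prod_type,
    Finset.sum_mul_sum]
  exact Finset.sum_congr rfl fun i _ => Finset.sum_congr rfl fun j _ => by ring

end TensorVec

section KroneckerSum

variable {n m : Type*} [DecidableEq n] [DecidableEq m]

/-- The **Kronecker sum** `A ⊗ 1 + 1 ⊗ B`: the Hamiltonian of two decoupled systems on the
product space (Kato 1966, II-§2.2; the `H₀ = H ⊗ 1 + 1 ⊗ H` of two decoupled clusters).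
[cite: Kato1966, II-§2.2] -/
def kroneckerSum (A : Matrix n n ℂ) (B : Matrix m m ℂ) : Matrix (n × m) (n × m) ℂ :=
  A ⊗ₖ (1 : Matrix m m ℂ) + (1 : Matrix n n ℂ) ⊗ₖ B

/-- The Kronecker sum of Hermitian matrices is Hermitian. [folklore] -/
theorem isHermitian_kroneckerSum {A : Matrix n n ℂ} {B : Matrix m m ℂ} (hA : A.IsHermitian)
    (hB : B.IsHermitian) : (kroneckerSum A B).IsHermitian := by
  unfold kroneckerSum
  refine IsHermitian.add ?_ ?_
  · unfold IsHermitian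
    rw [conjTranspose_kronecker, hA.eq, conjTranspose_one]
  · unfold IsHermitian
    rw [conjTranspose_kronecker, hB.eq, conjTranspose_one]

variable [Fintype n] [Fintype m]

omit [DecidableEq n] in
/-- `(A ⊗ 1)(x ⊗ y) = (A x) ⊗ y`. [folklore] -/
theorem kronecker_one_mulVec_tensorVec (A : Matrix n n ℂ) (x : n → ℂ) (y : m → ℂ) :
    (A ⊗ₖ (1 : Matrix m m ℂ)) *ᵥ tensorVec x y = tensorVec (A *ᵥ x) y := by
  funext p
  rcases p with ⟨i, j⟩
  simp only [mulVec, dotProduct, kroneckerMap_apply, tensorVec_apply, one_apply,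
    Fintype.sum_prod_type, mul_ite, mul_one, mul_zero, ite_mul, zero_mul, Finset.sum_ite_eq,
    Finset.mem_univ, if_true, Finset.sum_mul]
  exact Finset.sum_congr rfl fun k _ => by ring

omit [DecidableEq m] in
/-- `(1 ⊗ B)(x ⊗ y) = x ⊗ (B y)`. [folklore] -/
theorem one_kronecker_mulVec_tensorVec (B : Matrix m m ℂ) (x : n → ℂ) (y : m → ℂ) :
    ((1 : Matrix n n ℂ) ⊗ₖ B) *ᵥ tensorVec x y = tensorVec x (B *ᵥ y) := by
  funext p
  rcases p with ⟨i, j⟩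
  simp only [mulVec, dotProduct, kroneckerMap_apply, tensorVec_apply, one_apply,
    Fintype.sum_prod_type, ite_mul, one_mul, zero_mul, Finset.mul_sum]
  rw [Finset.sum_comm]
  simp only [Finset.sum_ite_eq, Finset.mem_univ, if_true]
  exact Finset.sum_congr rfl fun k _ => by ring

/-- **The Kronecker sum on product vectors**: `(A ⊗ 1 + 1 ⊗ B)(x ⊗ y) = Ax ⊗ y + x ⊗ By`.
[cite: Kato1966, II-§2.2] -/
theorem kroneckerSum_mulVec_tensorVec (A : Matrix n n ℂ) (B : Matrix m m ℂ) (x : n → ℂ)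
    (y : m → ℂ) :
    kroneckerSum A B *ᵥ tensorVec x y = tensorVec (A *ᵥ x) y + tensorVec x (B *ᵥ y) := by
  rw [kroneckerSum, add_mulVec, kronecker_one_mulVec_tensorVec, one_kronecker_mulVec_tensorVec]

/-- **Product eigenvectors**: if `A x = λ x` and `B y = μ y` then `x ⊗ y` is an eigenvector of the
Kronecker sum with eigenvalue `λ + μ` (the energies of decoupled systems add). [folklore] -/
theorem kroneckerSum_mulVec_tensorVec_of_eigenvector (A : Matrix n n ℂ) (B : Matrix m m ℂ)
    {x : n → ℂ} {y : m → ℂ} {lam mu : ℂ} (hx : A *ᵥ x = lam • x) (hy : B *ᵥ y = mu • y) :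
    kroneckerSum A B *ᵥ tensorVec x y = (lam + mu) • tensorVec x y := by
  rw [kroneckerSum_mulVec_tensorVec, hx, hy, tensorVec_smul_left, tensorVec_smul_right, add_smul]

end KroneckerSum

section Spectral

variable {n : Type*} [Fintype n] [DecidableEq n] {A : Matrix n n ℂ}

/-- A matrix–vector product is the linear combination of the columns:
`U w = Σ_μ w_μ · (col μ of U)`; for the eigenvector unitary the columns are Mathlib's
eigenvectors. [folklore] -/
theorem eigenvectorUnitary_mulVec_eq_sum (hA : A.IsHermitian) (w : n → ℂ) :
    (hA.eigenvectorUnitary : Matrix n n ℂ) *ᵥ w = ∑ μ, w μ • ⇑(hA.eigenvectorBasis μ) := by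
  funext i
  simp only [mulVec, dotProduct, IsHermitian.eigenvectorUnitary_apply, Finset.sum_apply,
    Pi.smul_apply, smul_eq_mul]
  exact Finset.sum_congr rfl fun μ _ => mul_comm _ _

/-- **Completeness of the eigenbasis** in the `dotProduct` language: every vector is
`v = Σ_μ ⟨u_μ, v⟩ u_μ` over Mathlib's orthonormal eigenbasis of a Hermitian matrix
(`v = U (U⋆ v)` for the eigenvector unitary `U`). [folklore] -/
theorem eq_sum_dotProduct_eigenvectorBasis_smul (hA : A.IsHermitian) (v : n → ℂ) :
    v = ∑ μ, (star ⇑(hA.eigenvectorBasis μ) ⬝ᵥ v) • ⇑(hA.eigenvectorBasis μ) := by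
  have hUu : (hA.eigenvectorUnitary : Matrix n n ℂ) ∈ unitary (Matrix n n ℂ) :=
    hA.eigenvectorUnitary.prop
  have hv : (hA.eigenvectorUnitary : Matrix n n ℂ) *ᵥ
      (star (hA.eigenvectorUnitary : Matrix n n ℂ) *ᵥ v) = v := by
    rw [mulVec_mulVec, Unitary.mul_star_self_of_mem hUu, one_mulVec]
  conv_lhs => rw [← hv]
  rw [eigenvectorUnitary_mulVec_eq_sum]
  exact Finset.sum_congr rfl fun μ _ => by rw [star_eigenvectorUnitary_mulVec_apply]

/-- **The pair resolvent kernel is the reduced resolvent of the Kronecker sum between product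
vectors**: `pairResolvent hA E a b c d = ⟨a ⊗ c, (A ⊗ 1 + 1 ⊗ A − E)⁻¹_red (b ⊗ d)⟩` with
`(·)⁻¹_red = reducedResolvent · E` Kato's reduced resolvent (Kato 1966, I-§5.3 (5.32)): the
"sum over intermediate states of two decoupled copies" (Tsai–Kivelson 2006, App. A) equals the
genuine resolvent matrix element, the terms `λ_μ + λ_ν = E` being dropped on both sides
(`0⁻¹ = 0`). [cite: Kato1966, I-§5.3 (5.32)] -/
theorem pairResolvent_eq_dotProduct_reducedResolvent_kroneckerSum (hA : A.IsHermitian) (E : ℝ)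
    (a b c d : n → ℂ) :
    pairResolvent hA E a b c d =
      star (tensorVec a c) ⬝ᵥ (reducedResolvent (kroneckerSum A A) E *ᵥ tensorVec b d) := by
  have hK : (kroneckerSum A A).IsHermitian := isHermitian_kroneckerSum hA hA
  -- product eigenvectors
  have hev : ∀ μ ν : n, kroneckerSum A A *ᵥ
      tensorVec ⇑(hA.eigenvectorBasis μ) ⇑(hA.eigenvectorBasis ν) =
        ((hA.eigenvalues μ + hA.eigenvalues ν : ℝ) : ℂ) •
          tensorVec ⇑(hA.eigenvectorBasis μ) ⇑(hA.eigenvectorBasis ν) := by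
    intro μ ν
    rw [kroneckerSum_mulVec_tensorVec_of_eigenvector A A (mulVec_eigenvectorBasis_coe hA μ)
      (mulVec_eigenvectorBasis_coe hA ν)]
    push_cast
    rfl
  -- expand `b` and `d` in the eigenbasis and push everything through the sums
  conv_rhs => rw [eq_sum_dotProduct_eigenvectorBasis_smul hA b,
    eq_sum_dotProduct_eigenvectorBasis_smul hA d, tensorVec_sum_smul_sum_smul, mulVec_sum,
    dotProduct_sum]
  unfold pairResolvent
  refine Finset.sum_congr rfl fun μ _ => ?_
  rw [mulVec_sum, dotProduct_sum]
  refine Finset.sum_congr rfl fun ν _ => ?_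
  rw [mulVec_smul, dotProduct_smul, reducedResolvent, hK.cfc_mulVec_of_eigenvector _ (hev μ ν),
    dotProduct_smul, star_tensorVec_dotProduct_tensorVec, smul_eq_mul, smul_eq_mul]
  push_cast
  ring

end Spectral

end Literature.MathematicalPhysics.QuantumLattice

end

noncomputable section

namespace Literature.MathematicalPhysics.QuantumLattice

open Matrix Finset JWEmbed TwoCluster

section TwoClusterKernel

variable {ι : Type*} [LinearOrder ι] [Fintype ι]

/-- The Hamiltonian of two decoupled copies of a cluster on `Fock (ι ⊕ₗ ι)`:
`H₀ = jwEmbed inlO H + jwEmbed inrO H` ("`H ⊗ 1 + 1 ⊗ H`"). [cite: TsaiKivelson2006, App. A] -/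
def twoClusterHamiltonian (H : Matrix (Finset ι) (Finset ι) ℂ) :
    Matrix (Finset (ι ⊕ₗ ι)) (Finset (ι ⊕ₗ ι)) ℂ :=
  jwEmbed inlO H + jwEmbed inrO H

/-- The inter-cluster hopping `V = −Σ_{i,j} W i j (c†_{inl i} c_{inr j} + c†_{inr j} c_{inl i})`
(unit amplitude `t' = 1` factored into `W`; `i` an orbital of cluster 1, `j` of cluster 2).
[cite: TsaiKivelson2006, App. A] -/
def interClusterHopping (W : ι → ι → ℝ) : Matrix (Finset (ι ⊕ₗ ι)) (Finset (ι ⊕ₗ ι)) ℂ :=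
  -∑ i, ∑ j, ((W i j : ℝ) : ℂ) •
    (creation (inlO i) * annihilation (inrO j) + creation (inrO j) * annihilation (inlO i))

/-- The inter-cluster hopping is Hermitian (real amplitudes). [folklore] -/
theorem interClusterHopping_isHermitian (W : ι → ι → ℝ) : (interClusterHopping W).IsHermitian := by
  unfold interClusterHopping IsHermitian
  rw [conjTranspose_neg]
  congr 1
  rw [conjTranspose_sum]
  refine Finset.sum_congr rfl fun i _ => ?_
  rw [conjTranspose_sum]
  refine Finset.sum_congr rfl fun j _ => ?_
  rw [conjTranspose_smul, conjTranspose_add, conjTranspose_mul, conjTranspose_mul]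
  simp only [creation, conjTranspose_conjTranspose, Complex.star_def, Complex.conj_ofReal]
  rw [add_comm]

/-- **Reduced-resolvent matrix elements between product states are pair resolvents**:
`⟨a ⊗ c, S_{H₀}(E) (b ⊗ d)⟩ = pairResolvent hH E a b c d` for the decoupled two-cluster
Hamiltonian of a parity-preserving Hermitian `H` (expand `b, d` in the eigenbasis; product states
of eigenvectors are eigenvectors with the sum of the energies; `cfc` on eigenvectors).
[cite: Kato1966, I-§5.3 (5.32)] -/
theorem star_prodState_dotProduct_reducedResolvent_prodState {H : Matrix (Finset ι) (Finset ι) ℂ}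
    (hH : H.IsHermitian) (hpar : IsParityPreserving H) (E : ℝ) (a b c d : Fock ι) :
    star (prodState a c) ⬝ᵥ (reducedResolvent (twoClusterHamiltonian H) E *ᵥ prodState b d) =
      pairResolvent hH E a b c d := by
  have hK : (twoClusterHamiltonian H).IsHermitian := isHermitian_twoClusterHamiltonian hH
  have hev : ∀ μ ν, twoClusterHamiltonian H *ᵥ
      prodState ⇑(hH.eigenvectorBasis μ) ⇑(hH.eigenvectorBasis ν) =
        ((hH.eigenvalues μ + hH.eigenvalues ν : ℝ) : ℂ) •
          prodState ⇑(hH.eigenvectorBasis μ) ⇑(hH.eigenvectorBasis ν) := by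
    intro μ ν
    rw [twoClusterHamiltonian, twoClusterHamiltonian_mulVec_prodState_of_eigenvector hpar
      (mulVec_eigenvectorBasis_coe hH μ) (mulVec_eigenvectorBasis_coe hH ν)]
    push_cast
    rfl
  conv_lhs => rw [eq_sum_dotProduct_eigenvectorBasis_smul hH b,
    eq_sum_dotProduct_eigenvectorBasis_smul hH d, prodState_sum_smul_sum_smul, mulVec_sum,
    dotProduct_sum]
  unfold pairResolvent
  refine Finset.sum_congr rfl fun μ _ => ?_
  rw [mulVec_sum, dotProduct_sum]
  refine Finset.sum_congr rfl fun ν _ => ?_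
  rw [mulVec_smul, dotProduct_smul, reducedResolvent, hK.cfc_mulVec_of_eigenvector _ (hev μ ν),
    dotProduct_smul, star_prodState_dotProduct_prodState, smul_eq_mul, smul_eq_mul]
  push_cast
  ring

/-- **The inter-cluster hopping on a product state** whose cluster-1 factor has fermion parity `p`:
`V (x ⊗ y) = (-1)^p Σ_{i,j} W i j [(c_i x) ⊗ (c†_j y) − (c†_i x) ⊗ (c_j y)]` — the Jordan–Wigner
string of the cluster-2 operators, `(-1)^{N₁}`, is `(-1)^p` when it acts before and `(-1)^{p+1}`
when it acts after the cluster-1 operator. [cite: TsaiKivelson2006, App. A (A1)–(A3)] -/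
theorem interClusterHopping_mulVec_prodState (W : ι → ι → ℝ) {p : ℕ} {x : Fock ι}
    (hx : HasParity p x) (y : Fock ι) :
    interClusterHopping W *ᵥ prodState x y =
      ((-1 : ℂ) ^ p) • ∑ i, ∑ j, ((W i j : ℝ) : ℂ) •
        (prodState (annihilation i *ᵥ x) (creation j *ᵥ y) -
          prodState (creation i *ᵥ x) (annihilation j *ᵥ y)) := by
  unfold interClusterHopping
  rw [neg_mulVec, sum_mulVec, Finset.smul_sum, ← Finset.sum_neg_distrib]
  refine Finset.sum_congr rfl fun i _ => ?_
  rw [sum_mulVec, Finset.smul_sum, ← Finset.sum_neg_distrib]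
  refine Finset.sum_congr rfl fun j _ => ?_
  rw [smul_mulVec, add_mulVec, ← mulVec_mulVec, ← mulVec_mulVec,
    annihilation_inrO_mulVec_prodState, parityOp_mulVec_of_hasParity hx, prodState_smul_left,
    mulVec_smul, creation_inlO_mulVec_prodState,
    annihilation_inlO_mulVec_prodState, creation_inrO_mulVec_prodState,
    parityOp_mulVec_of_hasParity (hx.annihilation_mulVec i), prodState_smul_left, pow_succ,
    mul_neg_one, neg_smul, ← sub_eq_add_neg, ← smul_sub, smul_comm ((W i j : ℝ) : ℂ) ((-1 : ℂ) ^ p),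
    ← smul_neg, ← smul_neg, neg_sub]

omit [Fintype ι] in
/-- `(-1)^p · (-1)^p = 1`. [folklore] -/
private theorem neg_one_pow_mul_self (p : ℕ) : ((-1 : ℂ) ^ p) * (-1) ^ p = 1 := by
  rw [← pow_add, ← two_mul, pow_mul]
  norm_num

omit [LinearOrder ι] in
/-- Sesquilinear expansion of `⟨Σ c' v', S (Σ c v)⟩` over double sums. [folklore] -/
private theorem star_sum_sum_dotProduct_mulVec_sum_sum {n : Type*} [Fintype n]
    (S : Matrix n n ℂ) (c c' : ι → ι → ℂ) (v v' : ι → ι → n → ℂ) :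
    star (∑ i', ∑ j', c' i' j' • v' i' j') ⬝ᵥ (S *ᵥ ∑ i, ∑ j, c i j • v i j) =
      ∑ i', ∑ j', ∑ i, ∑ j, star (c' i' j') * c i j * (star (v' i' j') ⬝ᵥ (S *ᵥ v i j)) := by
  rw [star_sum, sum_dotProduct]
  refine Finset.sum_congr rfl fun i' _ => ?_
  rw [star_sum, sum_dotProduct]
  refine Finset.sum_congr rfl fun j' _ => ?_
  rw [mulVec_sum, dotProduct_sum]
  refine Finset.sum_congr rfl fun i _ => ?_
  rw [mulVec_sum, dotProduct_sum]
  refine Finset.sum_congr rfl fun j _ => ?_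
  rw [star_smul, mulVec_smul, smul_dotProduct, dotProduct_smul, smul_eq_mul, smul_eq_mul]
  ring

/-- **THE IDENTIFICATION.** For a Hermitian, parity-preserving cluster Hamiltonian `H`, real
inter-cluster amplitudes `W`, and cluster states whose cluster-1 components `φ κ.1`, `φ κ'.1` have
a common fermion parity, the one-cluster formula `interClusterKernel` of `ClusterPairBosonCouplings`
is (minus) the matrix element of `V S(E) V` between the product states on `Fock (ι ⊕ₗ ι)`, i.e. it
IS Kato's second-order kernel `⟨κ'| V (E − H₀)⁻¹_red V |κ⟩` of the two-cluster system
(`(E − H₀)⁻¹_red = −S(E)`), at `E = (pairEnergy κ + pairEnergy κ')/2`.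
[cite: TsaiKivelson2006, App. A (A1)] -/
theorem interClusterKernel_eq {K : Type*} {H : Matrix (Finset ι) (Finset ι) ℂ} (hH : H.IsHermitian)
    (hpar : IsParityPreserving H) (φ : K → Fock ι) (W : ι → ι → ℝ) (κ' κ : K × K) {p : ℕ}
    (h1 : HasParity p (φ κ.1)) (h1' : HasParity p (φ κ'.1)) :
    star (prodState (φ κ'.1) (φ κ'.2)) ⬝ᵥ
        ((interClusterHopping W *
            reducedResolvent (twoClusterHamiltonian H) ((pairEnergy H φ κ + pairEnergy H φ κ') / 2) *
              interClusterHopping W) *ᵥ prodState (φ κ.1) (φ κ.2)) =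
      -interClusterKernel hH φ W κ' κ := by
  set E : ℝ := (pairEnergy H φ κ + pairEnergy H φ κ') / 2 with hE
  set S := reducedResolvent (twoClusterHamiltonian H) E with hS
  -- `⟨Ψ', V S V Ψ⟩ = ⟨V Ψ', S (V Ψ)⟩`
  rw [← mulVec_mulVec, ← mulVec_mulVec, star_dotProduct_mulVec (interClusterHopping W),
    (interClusterHopping_isHermitian W).eq, interClusterHopping_mulVec_prodState W h1',
    interClusterHopping_mulVec_prodState W h1, star_smul, mulVec_smul, smul_dotProduct,
    dotProduct_smul, smul_smul]
  rw [show star ((-1 : ℂ) ^ p) = (-1) ^ p by simp, neg_one_pow_mul_self, one_smul,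
    star_sum_sum_dotProduct_mulVec_sum_sum]
  -- the four resolvent matrix elements of each term are pair resolvents
  have hterm : ∀ i' j' i j : ι,
      star (((W i' j' : ℝ) : ℂ)) * ((W i j : ℝ) : ℂ) *
        (star (prodState (annihilation i' *ᵥ φ κ'.1) (creation j' *ᵥ φ κ'.2) -
            prodState (creation i' *ᵥ φ κ'.1) (annihilation j' *ᵥ φ κ'.2)) ⬝ᵥ
          (S *ᵥ (prodState (annihilation i *ᵥ φ κ.1) (creation j *ᵥ φ κ.2) -
            prodState (creation i *ᵥ φ κ.1) (annihilation j *ᵥ φ κ.2)))) =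
      -(((W i j * W i' j' : ℝ) : ℂ) *
        (pairResolvent hH E (creation i' *ᵥ φ κ'.1) (annihilation i *ᵥ φ κ.1)
            (annihilation j' *ᵥ φ κ'.2) (creation j *ᵥ φ κ.2) +
          pairResolvent hH E (annihilation i' *ᵥ φ κ'.1) (creation i *ᵥ φ κ.1)
            (creation j' *ᵥ φ κ'.2) (annihilation j *ᵥ φ κ.2) -
          pairResolvent hH E (annihilation i' *ᵥ φ κ'.1) (annihilation i *ᵥ φ κ.1)
            (creation j' *ᵥ φ κ'.2) (creation j *ᵥ φ κ.2) -
          pairResolvent hH E (creation i' *ᵥ φ κ'.1) (creation i *ᵥ φ κ.1)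
            (annihilation j' *ᵥ φ κ'.2) (annihilation j *ᵥ φ κ.2))) := by
    intro i' j' i j
    rw [mulVec_sub, dotProduct_sub, star_sub, sub_dotProduct, sub_dotProduct,
      star_prodState_dotProduct_reducedResolvent_prodState hH hpar,
      star_prodState_dotProduct_reducedResolvent_prodState hH hpar,
      star_prodState_dotProduct_reducedResolvent_prodState hH hpar,
      star_prodState_dotProduct_reducedResolvent_prodState hH hpar,
      Complex.star_def, Complex.conj_ofReal]
    push_cast
    ring
  simp only [hterm, Finset.sum_neg_distrib]
  -- reorder the quadruple sum `Σ i' j' i j ↦ Σ i j i' j'`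
  unfold interClusterKernel
  congr 1
  calc ∑ i', ∑ j', ∑ i, ∑ j, ((W i j * W i' j' : ℝ) : ℂ) * _
      = ∑ i', ∑ i, ∑ j', ∑ j, _ := Finset.sum_congr rfl fun i' _ => Finset.sum_comm
    _ = ∑ i, ∑ i', ∑ j', ∑ j, _ := Finset.sum_comm
    _ = ∑ i, ∑ i', ∑ j, ∑ j', _ :=
        Finset.sum_congr rfl fun i _ => Finset.sum_congr rfl fun i' _ => Finset.sum_comm
    _ = ∑ i, ∑ j, ∑ i', ∑ j', _ := Finset.sum_congr rfl fun i _ => Finset.sum_comm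

end TwoClusterKernel

end Literature.MathematicalPhysics.QuantumLattice

end

noncomputable section

namespace Literature.MathematicalPhysics.QuantumLattice

open Matrix Finset TwoCluster

/-- **Hubbard Hamiltonians are even**: hopping terms `c†_{xσ} c_{yσ}` and interaction terms
`n_{x↑} n_{x↓}` connect only configurations of equal fermion parity. [folklore] -/
theorem isParityPreserving_hamiltonian {Λ : Type*} [LinearOrder Λ] [Fintype Λ] (G : SimpleGraph Λ)
    [DecidableRel G.Adj] (t U : ℝ) : IsParityPreserving (hamiltonian G t U) := by
  unfold hamiltonian
  refine IsParityPreserving.add (IsParityPreserving.smul ?_ _) (IsParityPreserving.smul ?_ _)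
  · refine IsParityPreserving.sum fun x _ => IsParityPreserving.sum fun y _ =>
      IsParityPreserving.sum fun σ _ => ?_
    exact IsParityPreserving.ite _ (IsParityPreserving.creation_mul_annihilation _ _)
  · refine IsParityPreserving.sum fun x _ => ?_
    unfold numberOp
    exact (IsParityPreserving.creation_mul_annihilation _ _).mul
      (IsParityPreserving.creation_mul_annihilation _ _)

/-- The plaquette Hamiltonian is even. [folklore] -/
theorem isParityPreserving_plaquetteHamiltonian (U : ℝ) : IsParityPreserving (plaquetteHamiltonian U) :=
  isParityPreserving_hamiltonian plaquetteGraph 1 U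

/-- The plaquette states `|0h⟩` (4 electrons) and `|2h⟩` (2 electrons) are even. [folklore] -/
theorem hasParity_plaquetteStates (U : ℝ) (k : Fin 2) : HasParity 0 (plaquetteStates U k) := by
  have h := (plaquetteStates_spec U k).2.1
  rw [mem_szSector_iff] at h
  refine (hasParity_of_isNParticle h.1).mono ?_
  fin_cases k <;> rfl

/-- **The plaquette kernel is Kato's second-order kernel of two plaquettes**:
`plaquetteKernel U κ' κ = −⟨Ψ_κ', V S(E) V Ψ_κ⟩ = ⟨Ψ_κ', V (E − H₀)⁻¹_red V Ψ_κ⟩` for the product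
states `Ψ_κ = |κ.1⟩ ⊗ |κ.2⟩` of the two-plaquette Fock space, `H₀` the decoupled pair of plaquette
Hamiltonians, `V` the unit hopping on the two boundary bonds, `E = (E(κ) + E(κ'))/2`.
[cite: TsaiKivelson2006, App. A (A1)] -/
theorem plaquetteKernel_eq (U : ℝ) (κ' κ : Fin 2 × Fin 2) :
    plaquetteKernel U κ' κ =
      -(star (prodState (plaquetteStates U κ'.1) (plaquetteStates U κ'.2)) ⬝ᵥ
        ((interClusterHopping (bondHopping plaquetteBonds) *
            reducedResolvent (twoClusterHamiltonian (plaquetteHamiltonian U))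
              ((pairEnergy (plaquetteHamiltonian U) (plaquetteStates U) κ +
                  pairEnergy (plaquetteHamiltonian U) (plaquetteStates U) κ') / 2) *
            interClusterHopping (bondHopping plaquetteBonds)) *ᵥ
          prodState (plaquetteStates U κ.1) (plaquetteStates U κ.2))) := by
  have h := interClusterKernel_eq (plaquetteHamiltonian_isHermitian U)
    (isParityPreserving_plaquetteHamiltonian U) (plaquetteStates U) (bondHopping plaquetteBonds) κ' κ
    (hasParity_plaquetteStates U κ.1) (hasParity_plaquetteStates U κ'.1)
  exact neg_eq_iff_eq_neg.mp h.symm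

/-- **The pair-hopping coupling is the second-order pair-transfer amplitude**:
`J(U) = Re ⟨|2h⟩_R ⊗ |0h⟩_{R'}, V S(E) V (|0h⟩_R ⊗ |2h⟩_{R'})⟩` with `E = E(0h) + E(2h)` the energy of
the degenerate manifold (`pairEnergy (0,1) = pairEnergy (1,0)`), `S = reducedResolvent` — so that
`H_eff⁽²⁾ = V (E − H₀)⁻¹_red V = −V S V ∋ −J (b†_R b_{R'} + h.c.)`, the sign convention of
Yao–Tsai–Kivelson 2007, eq. (2). [cite: YaoTsaiKivelson2007, eq. (2)] -/
theorem plaquettePairCouplings_J_eq (U : ℝ) :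
    (plaquettePairCouplings U).J =
      (star (prodState (plaquetteStates U 1) (plaquetteStates U 0)) ⬝ᵥ
        ((interClusterHopping (bondHopping plaquetteBonds) *
            reducedResolvent (twoClusterHamiltonian (plaquetteHamiltonian U))
              ((pairEnergy (plaquetteHamiltonian U) (plaquetteStates U) ((0 : Fin 2), (1 : Fin 2)) +
                  pairEnergy (plaquetteHamiltonian U) (plaquetteStates U) ((1 : Fin 2), (0 : Fin 2))) / 2) *
            interClusterHopping (bondHopping plaquetteBonds)) *ᵥ
          prodState (plaquetteStates U 0) (plaquetteStates U 1))).re := by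
  have h1 : (plaquettePairCouplings U).J = -(plaquetteKernel U (1, 0) (0, 1)).re := by
    rw [plaquetteKernel_hop_re, neg_neg]
  rw [h1, plaquetteKernel_eq, Complex.neg_re, neg_neg]

end Literature.MathematicalPhysics.QuantumLattice

end
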